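import Literature.MathematicalPhysics.QuantumLattice.FinDimSpectrumProofs
import HarnessLib

/-!
# The ground-state (lattice, many-body) diamagnetic inequality for stoquastic Hamiltonians

Banked by the xylro-ideate cell (lens P3, generation g12) as the LICENCE LEMMA behind the
"defect diamagnetism" hypothesis of the defect-bootstrap lower bounds of
Scheer–Chadha–Lu–Khalaf (arXiv:2511.20860, Eq. (12)–(13) and App. E) [ScheerEtAl2025] and of the
BEC route `BECGroundStateSOS` ("defect/flux-threaded constraint sets …, licensed for bosons by the
diamagnetic inequality"); landed verbatim (helper identities made `private`, cite loci added) by the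
cell `hubbard-cq` prover seat p3 from `pub/xylro-ideate/memos/ROUTE-P3-g12-StoquasticDiamagnetic.lean`.
Declarations extend the tree's `Matrix.groundEnergy` API of `FinDimSpectrum(.Proofs)` and therefore
live in `namespace Matrix`, as those files do (deliberate dot-notation extension).

THE RESULT (finite-dimensional linear algebra; folklore — the `β = ∞`, lattice form of the
diamagnetic inequality, cf. Lieb–Loss, *Analysis* [LiebLoss2001, Thm. 7.21] (Kato's inequality
`|∇|ψ|| ≤ |(∇ − iA)ψ|`), B. Simon, *Kato's inequality and the comparison of semigroups*, J. Funct.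
Anal. 32 (1979) 97, and for lattice Laplacians with fluxes Lieb–Loss, *Fluxes, Laplacians, and
Kasteleyn's theorem* [LiebLoss1993, §1]; on the lattice it is the one-line variational argument
"replace `ψ` by `|ψ|`" of the Perron–Frobenius theorem, Lieb–Wu, Physica A 321 (2003) §2
[LiebWuPhysicaA2003], already used in the tree in `PerronFrobeniusGroundState.sum_abs_mul_abs_le`
and `XYZGroundStateOrderCorrIneq.groundProj_apply_nonneg`).

Let `A, B : Matrix n n ℂ` be Hermitian, `n` nonempty. If
* `Re B i i ≥ Re A i i` for all `i` (diagonal not lowered), and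
* `‖B i j‖ ≤ −Re (A i j)` for all `i ≠ j` (so in particular `A` is *stoquastic*: its off-diagonal
  entries have nonpositive real part, and the off-diagonal entries of `B` are dominated in modulus
  by those of `A`),
then `A.groundEnergy ≤ B.groundEnergy` (`Matrix.groundEnergy` of `FinDimSpectrum`).

PROOF.  Take a ground vector `ψ` of `B` (`groundSpace_ne_bot_holds`), `B ψ = E₀(B) ψ`, and the
entrywise modulus `|ψ| i = ‖ψ i‖`, which has the same norm. Then
`E₀(A)‖ψ‖² ≤ Re ⟨|ψ|, A |ψ|⟩ = Σᵢ Re Aᵢᵢ ‖ψᵢ‖² + Σ_{i≠j} Re Aᵢⱼ ‖ψᵢ‖‖ψⱼ‖`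
`≤ Σᵢ Re Bᵢᵢ ‖ψᵢ‖² − Σ_{i≠j} ‖Bᵢⱼ‖‖ψᵢ‖‖ψⱼ‖ ≤ Σᵢⱼ Re (ψ̄ᵢ Bᵢⱼ ψⱼ) = Re ⟨ψ, B ψ⟩ = E₀(B)‖ψ‖²`.

COROLLARIES (the forms consumers quote).
* `groundEnergy_le_groundEnergy_of_stoquastic_of_norm_le` — **defect diamagnetism for stoquastic
  `H`**: if `A` is Hermitian with REAL NONPOSITIVE off-diagonal entries (stoquastic in the given
  basis — hard-core / soft-core bosons with hopping `−t b†b`, `t ≥ 0`, quantum rotors / the XY model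
  in the occupation (S³) basis, the bipartite antiferromagnet after the Marshall sign change) and `B`
  is ANY Hermitian matrix with the same real parts on the diagonal and `‖B i j‖ ≤ ‖A i j‖` off the
  diagonal — e.g. `B` = `A` with Peierls phases / a twist / a flux tube / a U(1) defect inserted on
  any set of bonds — then `E₀(A) ≤ E₀(B)`: inserting phases never lowers the ground-state energy.
* `groundEnergy_le_groundEnergy_phases` — the special case `B i j = u i j * A i j`, `‖u i j‖ ≤ 1`
  off the diagonal, `u i i = 1`.
* `defectDiamagnetism_sum` — the literal shape of [ScheerEtAl2025, Eq. (12)]: summing the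
  inequality over the defect configurations `g` (the diagonal blocks `B g` of `H_defect`) gives
  `E₀(H) Σ_g ‖Φ_g‖² ≤ Σ_g Re ⟨Φ_g, B g Φ_g⟩ = Re ⟨Oψ, H_defect Oψ⟩` for EVERY vector, hence
  defect diamagnetism with respect to every constraint set `P`, at every finite size.
* Sector (fixed particle number / magnetisation) versions follow by applying the theorem to the
  principal submatrices `A.submatrix f f`, `B.submatrix f f` of a coordinate sector (the hypotheses
  are entrywise and `IsHermitian.submatrix` is Mathlib): `groundEnergy_submatrix_le_of_stoquastic`.

WHAT THIS DOES NOT SAY (the Hubbard side, for the record).  For lattice FERMIONS the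
occupation-basis matrix of the hopping term is not stoquastic (Jordan–Wigner signs), the lemma does
not apply, and its conclusion is FALSE at half filling: the tree proves Lieb's flux-phase theorem
`Lieb1994_fluxPi_torus_holds` (`LiebFluxPhaseProofs.lean`) [Lieb1994] — on the even square torus
flux `π`, not flux `0`, minimises the ground-state energy for every `U`; at `U = 0` the gap is strict
and explicit: `E₀(flux 0) = 2 Σ_k min(−2(cos k₁ + cos k₂), 0) = −24 t` versus
`E₀(flux π) = −2 Σ_k √(cos² k₁ + cos² k₂) = −(16 + 8√2) t ≈ −27.31 t` on the `4 × 4` torus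
(per site `−16/π² ≈ −1.621 t` vs `−1.916 t` as `L → ∞`).

No `sorry`; axioms standard. Mathlib + `FinDimSpectrumProofs` only.
-/

noncomputable section

open scoped ComplexOrder

namespace Matrix

open Literature.MathematicalPhysics.QuantumLattice Finset

variable {n : Type*} [Fintype n] [DecidableEq n]

/-- The entrywise modulus `|v| i = ‖v i‖` of a complex vector, as a complex vector. [folklore] -/
def absVec (v : n → ℂ) : n → ℂ := fun i => ((‖v i‖ : ℝ) : ℂ)

omit [Fintype n] [DecidableEq n] in
/-- Unfolding of `absVec`. [folklore] -/
@[simp] private theorem absVec_apply (v : n → ℂ) (i : n) : absVec v i = ((‖v i‖ : ℝ) : ℂ) := rfl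

omit [DecidableEq n] in
/-- `|v|` has the same norm as `v`: `⟨|v|, |v|⟩ = ⟨v, v⟩`. [folklore] -/
private theorem star_absVec_dotProduct_absVec (v : n → ℂ) :
    star (absVec v) ⬝ᵥ absVec v = star v ⬝ᵥ v := by
  simp only [dotProduct, Pi.star_apply, absVec_apply, Complex.star_def, Complex.conj_ofReal,
    Complex.conj_mul']
  refine Finset.sum_congr rfl fun i _ => ?_
  ring

omit [DecidableEq n] in
/-- `Re ⟨v, v⟩ = Σᵢ ‖vᵢ‖²`. [folklore] -/
private theorem re_star_dotProduct_self_eq_sum (v : n → ℂ) :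
    (star v ⬝ᵥ v).re = ∑ i, ‖v i‖ ^ 2 := by
  simp only [dotProduct, Pi.star_apply, Complex.star_def, Complex.conj_mul', Complex.re_sum]
  refine Finset.sum_congr rfl fun i _ => ?_
  rw [← Complex.ofReal_pow, Complex.ofReal_re]

omit [DecidableEq n] in
/-- `Re ⟨v, v⟩ > 0` for `v ≠ 0`. [folklore] -/
private theorem re_star_dotProduct_self_pos {v : n → ℂ} (hv : v ≠ 0) : 0 < (star v ⬝ᵥ v).re := by
  rw [re_star_dotProduct_self_eq_sum]
  obtain ⟨i, hi⟩ := Function.ne_iff.mp hv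
  have hi' : 0 < ‖v i‖ ^ 2 := pow_pos (norm_pos_iff.mpr hi) 2
  exact lt_of_lt_of_le hi'
    (Finset.single_le_sum (f := fun j => ‖v j‖ ^ 2) (fun j _ => sq_nonneg ‖v j‖) (Finset.mem_univ i))

omit [DecidableEq n] in
/-- `Re ⟨w, M w⟩ = Σᵢⱼ Re (w̄ᵢ Mᵢⱼ wⱼ)`. [folklore] -/
private theorem re_star_dotProduct_mulVec_eq_sum (M : Matrix n n ℂ) (w : n → ℂ) :
    (star w ⬝ᵥ M *ᵥ w).re = ∑ i, ∑ j, ((starRingEnd ℂ) (w i) * (M i j * w j)).re := by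
  simp only [dotProduct, mulVec, Pi.star_apply, Complex.star_def, Finset.mul_sum, Complex.re_sum]

omit [DecidableEq n] in
/-- THE COMPARISON OF QUADRATIC FORMS behind the diamagnetic inequality: if the diagonal of `B`
is not below that of `A` (real parts) and the off-diagonal entries of `B` are dominated in modulus
by MINUS the (hence nonpositive) real parts of those of `A`, then `Re ⟨|v|, A |v|⟩ ≤ Re ⟨v, B v⟩`
for every complex vector `v`. Lieb–Wu (2003) §2 ("`|f| Ĥ |f| ≤ f Ĥ f`"); [LiebLoss2001, Thm. 7.21].
[cite: LiebWuPhysicaA2003, §2] -/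
theorem re_quadForm_absVec_le {A B : Matrix n n ℂ} (hdiag : ∀ i, (A i i).re ≤ (B i i).re)
    (hoff : ∀ i j, i ≠ j → ‖B i j‖ ≤ -(A i j).re) (v : n → ℂ) :
    (star (absVec v) ⬝ᵥ A *ᵥ absVec v).re ≤ (star v ⬝ᵥ B *ᵥ v).re := by
  rw [re_star_dotProduct_mulVec_eq_sum, re_star_dotProduct_mulVec_eq_sum]
  refine Finset.sum_le_sum fun i _ => Finset.sum_le_sum fun j _ => ?_
  have hL : ((starRingEnd ℂ) (absVec v i) * (A i j * absVec v j)).re =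
      (A i j).re * (‖v i‖ * ‖v j‖) := by
    simp only [absVec_apply, Complex.conj_ofReal, Complex.mul_re, Complex.ofReal_re,
      Complex.ofReal_im, Complex.mul_im]
    ring
  rw [hL]
  by_cases hij : i = j
  · subst hij
    have hR : ((starRingEnd ℂ) (v i) * (B i i * v i)).re = (B i i).re * (‖v i‖ * ‖v i‖) := by
      have h1 : (starRingEnd ℂ) (v i) * (B i i * v i) = B i i * ((starRingEnd ℂ) (v i) * v i) := by
        ring
      rw [h1, Complex.conj_mul', ← Complex.ofReal_pow, Complex.mul_re, Complex.ofReal_re,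
        Complex.ofReal_im]
      ring
    rw [hR]
    exact mul_le_mul_of_nonneg_right (hdiag i) (mul_nonneg (norm_nonneg _) (norm_nonneg _))
  · have hvv : 0 ≤ ‖v i‖ * ‖v j‖ := mul_nonneg (norm_nonneg _) (norm_nonneg _)
    calc (A i j).re * (‖v i‖ * ‖v j‖)
        ≤ -‖B i j‖ * (‖v i‖ * ‖v j‖) :=
          mul_le_mul_of_nonneg_right (by linarith [hoff i j hij]) hvv
      _ = -‖(starRingEnd ℂ) (v i) * (B i j * v j)‖ := by
          rw [norm_mul, norm_mul, Complex.norm_conj]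
          ring
      _ ≤ ((starRingEnd ℂ) (v i) * (B i j * v j)).re :=
          (abs_le.mp (Complex.abs_re_le_norm _)).1

/-- **The ground-state diamagnetic inequality (stoquastic domination).** For Hermitian `A`, `B` on
a nonempty index type with `Re Bᵢᵢ ≥ Re Aᵢᵢ` and `‖Bᵢⱼ‖ ≤ −Re Aᵢⱼ` (`i ≠ j`):
`E₀(A) ≤ E₀(B)`. The lattice, zero-temperature form of the diamagnetic inequality ([LiebLoss2001, Thm. 7.21];
[LiebLoss1993, §1]; Simon, J. Funct. Anal. 32 (1979) 97); proof = the `|ψ|` trick of the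
Perron–Frobenius theorem (Lieb–Wu 2003 §2) applied to a ground vector of `B`.
[cite: LiebWuPhysicaA2003, §2] -/
theorem groundEnergy_le_groundEnergy_of_norm_offDiag_le [Nonempty n] {A B : Matrix n n ℂ}
    (hA : A.IsHermitian) (hB : B.IsHermitian) (hdiag : ∀ i, (A i i).re ≤ (B i i).re)
    (hoff : ∀ i j, i ≠ j → ‖B i j‖ ≤ -(A i j).re) :
    A.groundEnergy ≤ B.groundEnergy := by
  obtain ⟨ψ, hψ, hψ0⟩ := (Submodule.ne_bot_iff _).1 (groundSpace_ne_bot_holds hB)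
  have hBψ : B *ᵥ ψ = (B.groundEnergy : ℂ) • ψ := (mem_groundSpace_iff B ψ).1 hψ
  have hpos : 0 < (star ψ ⬝ᵥ ψ).re := re_star_dotProduct_self_pos hψ0
  -- variational principle for `A` at the trial vector `|ψ|`
  have h1 : A.groundEnergy * (star ψ ⬝ᵥ ψ).re ≤ (star (absVec ψ) ⬝ᵥ A *ᵥ absVec ψ).re := by
    have h := (posSemidef_sub_groundEnergy hA).dotProduct_mulVec_nonneg (absVec ψ)
    rw [sub_mulVec, dotProduct_sub, Algebra.algebraMap_eq_smul_one, smul_mulVec, one_mulVec,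
      dotProduct_smul, star_absVec_dotProduct_absVec] at h
    obtain ⟨hre, -⟩ := Complex.nonneg_iff.mp h
    simp only [Complex.sub_re, Complex.real_smul, Complex.re_ofReal_mul] at hre
    linarith
  -- the comparison of quadratic forms
  have h2 := re_quadForm_absVec_le hdiag hoff ψ
  -- `ψ` is a ground vector of `B`
  have h3 : (star ψ ⬝ᵥ B *ᵥ ψ).re = B.groundEnergy * (star ψ ⬝ᵥ ψ).re := by
    rw [hBψ, dotProduct_smul, smul_eq_mul, Complex.re_ofReal_mul]
  exact le_of_mul_le_mul_right (by linarith) hpos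

/-- **Defect diamagnetism for stoquastic Hamiltonians.** If `A` is Hermitian and STOQUASTIC in
the given basis (off-diagonal entries real and `≤ 0`) and `B` is Hermitian with the same diagonal
real parts and off-diagonal entries dominated in modulus, `‖Bᵢⱼ‖ ≤ ‖Aᵢⱼ‖` — e.g. `A` with
arbitrary Peierls phases / a boundary twist / a flux or U(1) defect inserted on any bonds — then
`E₀(A) ≤ E₀(B)`: phases never lower the ground-state energy of a stoquastic Hamiltonian. This is
the validity lemma ("defect diamagnetism") of the defect bootstrap of Scheer–Chadha–Lu–Khalaf,
arXiv:2511.20860, Eq. (12)–(13), App. E, for bosons / rotors / XY. [cite: ScheerEtAl2025, App. E] -/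
theorem groundEnergy_le_groundEnergy_of_stoquastic_of_norm_le [Nonempty n] {A B : Matrix n n ℂ}
    (hA : A.IsHermitian) (hB : B.IsHermitian)
    (hstoq : ∀ i j, i ≠ j → (A i j).im = 0 ∧ (A i j).re ≤ 0)
    (hdiag : ∀ i, (B i i).re = (A i i).re) (hmod : ∀ i j, i ≠ j → ‖B i j‖ ≤ ‖A i j‖) :
    A.groundEnergy ≤ B.groundEnergy := by
  refine groundEnergy_le_groundEnergy_of_norm_offDiag_le hA hB (fun i => (hdiag i).ge) ?_
  intro i j hij
  obtain ⟨him, hre⟩ := hstoq i j hij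
  have hz : A i j = (((A i j).re : ℝ) : ℂ) := Complex.ext (by simp) (by simp [him])
  have hnorm : ‖A i j‖ = -(A i j).re := by
    rw [hz, Complex.norm_real, Real.norm_eq_abs, abs_of_nonpos hre, Complex.ofReal_re]
  rw [← hnorm]
  exact hmod i j hij

/-- **Phase dressing never lowers a stoquastic ground-state energy.** `B i j = u i j * A i j` with
`‖u i j‖ ≤ 1` off the diagonal and `u i i = 1` (Peierls substitution `u = e^{iθ}` on the twisted
bonds, `u = 1` elsewhere), `A` stoquastic, both Hermitian: `E₀(A) ≤ E₀(B)`.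
[cite: ScheerEtAl2025, App. E] -/
theorem groundEnergy_le_groundEnergy_phases [Nonempty n] {A : Matrix n n ℂ} (hA : A.IsHermitian)
    (hstoq : ∀ i j, i ≠ j → (A i j).im = 0 ∧ (A i j).re ≤ 0) (u : n → n → ℂ)
    (hu : ∀ i j, i ≠ j → ‖u i j‖ ≤ 1) (hud : ∀ i, u i i = 1)
    (hB : (Matrix.of fun i j => u i j * A i j).IsHermitian) :
    A.groundEnergy ≤ (Matrix.of fun i j => u i j * A i j).groundEnergy := by
  refine groundEnergy_le_groundEnergy_of_stoquastic_of_norm_le hA hB hstoq ?_ ?_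
  · intro i
    simp [hud i]
  · intro i j hij
    rw [Matrix.of_apply, norm_mul]
    calc ‖u i j‖ * ‖A i j‖ ≤ 1 * ‖A i j‖ :=
          mul_le_mul_of_nonneg_right (hu i j hij) (norm_nonneg _)
      _ = ‖A i j‖ := one_mul _


omit [DecidableEq n] in
/-- `Re ⟨v, v⟩ ≥ 0`. [folklore] -/
private theorem re_star_dotProduct_self_nonneg (v : n → ℂ) : 0 ≤ (star v ⬝ᵥ v).re := by
  rw [re_star_dotProduct_self_eq_sum]
  exact Finset.sum_nonneg fun i _ => sq_nonneg ‖v i‖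

/-- Homogeneous variational principle: `E₀(B) · ‖φ‖² ≤ Re ⟨φ, B φ⟩` for every vector `φ`
(`B − E₀(B) ≥ 0`, `posSemidef_sub_groundEnergy`). Tasaki (2020) §2.1, (2.1.6). [cite: Tasaki2020, §2.1 (2.1.6)] -/
theorem groundEnergy_mul_le_re_quadForm {B : Matrix n n ℂ} (hB : B.IsHermitian) (φ : n → ℂ) :
    B.groundEnergy * (star φ ⬝ᵥ φ).re ≤ (star φ ⬝ᵥ B *ᵥ φ).re := by
  have h := (posSemidef_sub_groundEnergy hB).dotProduct_mulVec_nonneg φ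
  rw [sub_mulVec, dotProduct_sub, Algebra.algebraMap_eq_smul_one, smul_mulVec, one_mulVec,
    dotProduct_smul] at h
  obtain ⟨hre, -⟩ := Complex.nonneg_iff.mp h
  simp only [Complex.sub_re, Complex.real_smul, Complex.re_ofReal_mul] at hre
  linarith

/-- **Defect diamagnetism in the form of Scheer–Chadha–Lu–Khalaf, Eq. (12).** Let `A` (the
physical Hamiltonian `H`, identity sector) be Hermitian and let `B g`, `g ∈ s`, be the Hamiltonians
of the defect configurations (the diagonal blocks of `H_defect`, which is block diagonal over defect
configurations), each Hermitian, with diagonal real parts not below those of `A` and off-diagonal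
entries dominated in modulus by minus the (nonpositive) real parts of those of `A` — the situation of
an ABELIAN on-site symmetry acting diagonally in a basis in which `H` is stoquastic (U(1) bosons /
rotors / XY in the occupation basis, the TFIM in the `σˣ` basis), where every defect configuration is
a Peierls dressing of the bond terms by unimodular factors. Then for every family of sector components
`Φ g` (of the vector `O|ψ⟩`, `O ∈ P` arbitrary):
`E₀(H) · Σ_g ‖Φ g‖² ≤ Σ_g Re ⟨Φ g, B g Φ g⟩ = Re ⟨Oψ, H_defect Oψ⟩`, i.e. Eq. (12) holds for EVERY
constraint set `P` (and Eq. (13) termwise). [cite: ScheerEtAl2025, Eq. (12)] -/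
theorem defectDiamagnetism_sum [Nonempty n] {ι : Type*} (s : Finset ι) {A : Matrix n n ℂ}
    {B : ι → Matrix n n ℂ} (hA : A.IsHermitian) (hB : ∀ g, (B g).IsHermitian)
    (hdiag : ∀ g i, (A i i).re ≤ (B g i i).re) (hoff : ∀ g i j, i ≠ j → ‖B g i j‖ ≤ -(A i j).re)
    (Φ : ι → n → ℂ) :
    A.groundEnergy * ∑ g ∈ s, (star (Φ g) ⬝ᵥ Φ g).re ≤ ∑ g ∈ s, (star (Φ g) ⬝ᵥ B g *ᵥ Φ g).re := by
  rw [Finset.mul_sum]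
  refine Finset.sum_le_sum fun g _ => ?_
  calc A.groundEnergy * (star (Φ g) ⬝ᵥ Φ g).re
      ≤ (B g).groundEnergy * (star (Φ g) ⬝ᵥ Φ g).re :=
        mul_le_mul_of_nonneg_right
          (groundEnergy_le_groundEnergy_of_norm_offDiag_le hA (hB g) (hdiag g) (hoff g))
          (re_star_dotProduct_self_nonneg _)
    _ ≤ (star (Φ g) ⬝ᵥ B g *ᵥ Φ g).re := groundEnergy_mul_le_re_quadForm (hB g) (Φ g)

omit [Fintype n] [DecidableEq n] in
/-- **Sector version** (fixed particle number / magnetisation = a coordinate sector `f : m ↪ n`):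
the same domination hypotheses on the principal submatrices give
`E₀(A|_sector) ≤ E₀(B|_sector)`. [cite: LiebWuPhysicaA2003, §2] -/
theorem groundEnergy_submatrix_le_of_norm_offDiag_le {m : Type*} [Fintype m] [DecidableEq m]
    [Nonempty m] {A B : Matrix n n ℂ} (hA : A.IsHermitian) (hB : B.IsHermitian) (f : m → n)
    (hf : Function.Injective f) (hdiag : ∀ i, (A i i).re ≤ (B i i).re)
    (hoff : ∀ i j, i ≠ j → ‖B i j‖ ≤ -(A i j).re) :
    (A.submatrix f f).groundEnergy ≤ (B.submatrix f f).groundEnergy :=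
  groundEnergy_le_groundEnergy_of_norm_offDiag_le (hA.submatrix f) (hB.submatrix f)
    (fun i => hdiag (f i)) fun i j hij => hoff (f i) (f j) (fun h => hij (hf h))

end Matrix

end
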